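import Summits.QuantumFields.QCD.Theses.QuarksAsStableAction
import Summits.QuantumFields.QCD.Theorems.ChiralDescent.Negative.FlavourGuard
import Summits.QuantumFields.QCD.Theorems.LightQuarkCompletion.Negative.Anatomy

/-!
# Crux `MassContinuation` (stmt-QuantumFields-18327; QuarksAsStableAction r6 = SpectralDefectExtinction r8),
# negative side — anatomy, frame symmetry, the load-bearing uniform rate, and the RP-wall obligation

Refuter crux-attack (refuter-rattack-stmt-QuantumFields-18327-0, 2026-08-17).  NO refutation: the crux survives every
cheap attack, and this file records WHY in kernel-checked form (sorry-free, standard axioms).  Written over the tree's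
verbatim half-orthant body `LightQuarkCompletion.Negative.Body` and its RGI up-shift `upShift` (nothing duplicated); the
`def`s here are statement abbreviations (the crux's own clauses and one hypothesis-deleted variant) and ONE explicit
regularisation (`wallReg`); nothing asserts a Theses decl.

* §0 ANATOMY.  `massContinuation_iff` (`Iff.rfl`): the crux is `∀ N_f ∈ {2,3} ∀ reg M ε, At N_f reg M ε` with
  `At := HasMassScaling → 0 < ε → Body above M → GapAbove reg M ε → ∃ δ > 0, Body above (M − δ)`;
  `massContinuation_eq_spectral` (`rfl`): the two route decls are one term (one landing closes the shared item).
* §1 NOT THE TARGET IN COSTUME, NOT JUNK-CLOSABLE.  `massContinuation_of_noBody`: if NO mass-scaling regularisation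
  carries the `QCDOf` body on a half-orthant (the world where threshold QCD is false) the crux holds VACUOUSLY — so
  `MassContinuation → QCD` cannot be a theorem short of `ThresholdQCD ∨ QCD`; dually `at_of_bodyAt_all`: it is trivial for
  a regularisation good at every tuple.  The antecedent is not junk-inhabitable: `bodyAt_forces_construction` (a good
  tuple carries `IsQCDFor`-tied OS data that are non-trivial, hence not the vacuum — the tree's only inhabitant of
  `IsQCDFor`), so neither "hypotheses ⊢ False" nor "⊢ conclusion" is available.
* §2 FRAME.  The flavour-blind additive offset is a SYMMETRY, not a loophole: `upShift reg D` (`m_crit ↦ m_crit + a D/Z_m`)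
  transports body, uniform gap and the crux instance (`at_upShift`), whence `massContinuation_iff_zeroThreshold`:
  WLOG `M = 0`.  Rate: `at_of_at_smaller` (the instance at a smaller rate implies the instance at a larger one), so only
  small `ε` matter.
* §3 THE UNIFORM RATE IS LOAD-BEARING (modulo the two sibling pieces).  A per-tuple rate is already inside the body
  (`gapAbove_pointwise_of_body`), so "H2 with an `m`-dependent rate" is the gap-free variant `WithoutUniformGap` ("the
  good half-orthants form an open family"); `not_withoutUniformGap_of : ThresholdQCD → ChiralTupleGapless →
  ¬ WithoutUniformGap` by the least-admissible-threshold argument (`false_of_openBelow`: the admissible thresholds form a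
  non-empty up-set bounded below by the least component of the gapless tuple, containing its infimum because the
  orthants are strict; openness there contradicts `csInf_le`).  Any proof must use the ONE rate `ε` down to the corner.
* §4 THE RP-WALL OBLIGATION (hidden in the formalisation, absent from the informal sketch).  `IsQCDAlong` carries the
  `m`-DEPENDENT side condition `∀ f, ∀ᶠ k, −1 < m_f(k)` (physical branch `κ < 1/6`).  `branch_below_of_at`: any proof of
  the crux proves that body + uniform gap above `M` push this wall STRICTLY below `M`.  The explicit mass-scaling
  regularisation `wallReg N_f M` (`canonicalAF` with `m_crit(k) = −1 − a_k (M − 1/(k+1))/Z_m(k)`) has its bare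
  trajectories eventually on the physical branch EXACTLY for `m_f ≥ M` (`wallReg_eventually_branch_iff`), so its body
  fails at every tuple with a component `< M` for that formal reason alone (`not_bodyAt_wallReg`, `not_body_wallReg`),
  and the crux specialises to the NO-GO `wall_noGo_of_massContinuation`: for every `M`, `ε > 0`, `wallReg` does not
  carry body + uniform rate above `M` — "no dynamical-quark, uniformly gapped continuum limit along bare Wilson masses
  `→ −1⁺` (`κ → 1/6⁻`) at two-loop asymptotic scaling".  Physically expected (all fermion modes at the cut-off: the
  flavour-changing pseudoscalar goes white-noise), but it is a decoupling theorem in a regime where no hopping expansion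
  converges for rough gauge fields, and the informal proof (analyticity in the bare mass + Vitali around `M`) never meets
  it.  Cheapest repair if the planner wants the crux to be ONLY the continuation statement: add the hypothesis
  `∃ δ₀ > 0, ∀ m, (∀ f, M − δ₀ < m f) → ∀ f, ∀ᶠ k in atTop, −1 < (reg.scheme m 0 0).mq f k`.
  Not a misstatement: the unrepaired crux is still expected TRUE.
-/

noncomputable section

namespace Summit.QuantumFields.QCD.Theorems.MassContinuation.Negative

open Filter Topology
open Literature.MathematicalPhysics.QuantumFieldTheory
open Summit.QuantumFields.QCD.Theses
open Summit.QuantumFields.QCD.Theorems.ChiralDescent.Negative (hasLatticeMassGap_mono)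
open Summit.QuantumFields.QCD.Theorems.LightQuarkCompletion.Negative

variable {Nf : ℕ}

/-! ## §0 Anatomy (definitional packaging) -/

/-- The per-tuple `QCDOf` body (verbatim: conclusion of hypothesis 1 at one tuple). Statement abbreviation. -/
def BodyAt (reg : QCDRegularisation Nf) (m : Fin Nf → ℝ) : Prop :=
  ∃ (z shift : QCDField Nf → ℕ → ℝ) (T : OSData (QCDField Nf) 4),
    IsQCDAlong (reg.scheme m z shift) T ∧ T.IsNontrivial QCDField.glue ∧ T.IsNonGaussian QCDField.glue ∧
      (∀ f g : Fin Nf, f ≠ g → T.IsNontrivial (QCDField.pseudoRe f g)) ∧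
        ∃ Δ > 0, T.HasMassGap Δ ∧ (reg.scheme m z shift).HasLatticeMassGap Δ

/-- The tree's half-orthant body `Body` is "`BodyAt` on the strict half-orthant". [folklore] -/
theorem body_iff (reg : QCDRegularisation Nf) (M : ℝ) :
    Body Nf reg M ↔ ∀ m : Fin Nf → ℝ, (∀ f, M < m f) → BodyAt reg m :=
  Iff.rfl

/-- ONE lattice rate `ε` on the strict half-orthant above `M` (hypothesis 2). Statement abbreviation. -/
def GapAbove (reg : QCDRegularisation Nf) (M ε : ℝ) : Prop :=
  ∀ m : Fin Nf → ℝ, (∀ f, M < m f) → (reg.scheme m 0 0).HasLatticeMassGap ε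

variable (Nf) in
/-- The crux at one `(N_f, reg, M, ε)`. Statement abbreviation. -/
def At (reg : QCDRegularisation Nf) (M ε : ℝ) : Prop :=
  reg.HasMassScaling → 0 < ε → Body Nf reg M → GapAbove reg M ε → ∃ δ > 0, Body Nf reg (M - δ)

/-- The crux, clause by clause (definitional). [folklore] -/
theorem massContinuation_iff :
    QuarksAsStableAction.MassContinuation ↔
      ∀ Nf : ℕ, Nf = 2 ∨ Nf = 3 → ∀ (reg : QCDRegularisation Nf) (M ε : ℝ), At Nf reg M ε :=
  Iff.rfl

/-- The two route decls carrying item stmt-QuantumFields-18327 are one term. [folklore] -/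
theorem massContinuation_eq_spectral :
    QuarksAsStableAction.MassContinuation = SpectralDefectExtinction.MassContinuation :=
  rfl

/-! ## §1 Not the target in costume; not closable from junk -/

/-- **Vacuous in the no-threshold world**: if no mass-scaling regularisation carries the body on any half-orthant, the
crux holds.  Hence `MassContinuation → QCD` is not provable short of `ThresholdQCD ∨ QCD`. [folklore] -/
theorem massContinuation_of_noBody
    (h : ∀ Nf : ℕ, Nf = 2 ∨ Nf = 3 → ∀ (reg : QCDRegularisation Nf) (M : ℝ),
      reg.HasMassScaling → ¬ Body Nf reg M) :
    QuarksAsStableAction.MassContinuation :=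
  fun Nf hNf reg M _ hMS _ hB _ => (h Nf hNf reg M hMS hB).elim

/-- **Trivial for an everywhere-good regularisation** (the conclusion never asks more than the body). [folklore] -/
theorem at_of_bodyAt_all {reg : QCDRegularisation Nf} {M ε : ℝ} (h : ∀ m, BodyAt reg m) : At Nf reg M ε :=
  fun _ _ _ _ => ⟨1, one_pos, fun m _ => h m⟩

/-- **The antecedent forces a construction**: a good tuple carries `IsQCDFor`-tied OS data with a non-trivial glue
field, in particular NOT the vacuum data (the tree's only inhabitant of `IsQCDFor`). [folklore] -/
theorem bodyAt_forces_construction {reg : QCDRegularisation Nf} {m : Fin Nf → ℝ} (h : BodyAt reg m) :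
    ∃ T : OSData (QCDField Nf) 4, IsQCDFor Nf T ∧ T.IsNontrivial QCDField.glue ∧ T ≠ OSData.vacuum _ _ := by
  obtain ⟨z, shift, T, hQ, hN, -⟩ := h
  refine ⟨T, ⟨_, hQ⟩, hN, ?_⟩
  rintro rfl
  exact OSData.not_isNontrivial_vacuum _ hN

/-! ## §2 Frame: the additive offset is a symmetry (WLOG `M = 0`); only small rates matter -/

/-- The body at one tuple is transported by the up-shift. [folklore] -/
theorem bodyAt_upShift (reg : QCDRegularisation Nf) (D : ℝ) (m : Fin Nf → ℝ) :
    BodyAt (upShift reg D) m ↔ BodyAt reg (fun f => D + m f) := by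
  simp only [BodyAt, upShift_scheme]

/-- Half-orthant bodies are transported by the up-shift (both ways). [folklore] -/
theorem body_upShift_iff (reg : QCDRegularisation Nf) (D M : ℝ) :
    Body Nf (upShift reg D) M ↔ Body Nf reg (M + D) := by
  constructor
  · intro h m hm
    have h' : BodyAt (upShift reg D) (fun f => m f - D) := h _ (fun f => by linarith [hm f])
    have hfun : (fun f => D + (m f - D)) = m := funext fun f => by ring
    rw [bodyAt_upShift, hfun] at h'
    exact h'
  · intro h m hm
    show BodyAt (upShift reg D) m
    rw [bodyAt_upShift]
    exact h _ (fun f => by linarith [hm f])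

/-- Uniform rates are transported by the up-shift (both ways). [folklore] -/
theorem gapAbove_upShift_iff (reg : QCDRegularisation Nf) (D M ε : ℝ) :
    GapAbove (upShift reg D) M ε ↔ GapAbove reg (M + D) ε := by
  constructor
  · intro h m hm
    have h' := h (fun f => m f - D) (fun f => by linarith [hm f])
    have hfun : (fun f => D + (m f - D)) = m := funext fun f => by ring
    rw [upShift_scheme, hfun] at h'
    exact h'
  · intro h m hm
    rw [upShift_scheme]
    exact h _ (fun f => by linarith [hm f])

/-- The crux instance is transported by the up-shift. [folklore] -/
theorem at_upShift_iff (reg : QCDRegularisation Nf) (D M ε : ℝ) :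
    At Nf (upShift reg D) M ε ↔ At Nf reg (M + D) ε := by
  simp only [At, hasMassScaling_upShift, body_upShift_iff, gapAbove_upShift_iff, sub_add_eq_add_sub]

/-- **WLOG `M = 0`**: the crux is equivalent to its instances at threshold `0`. [folklore] -/
theorem massContinuation_iff_zeroThreshold :
    QuarksAsStableAction.MassContinuation ↔
      ∀ Nf : ℕ, Nf = 2 ∨ Nf = 3 → ∀ (reg : QCDRegularisation Nf) (ε : ℝ), At Nf reg 0 ε := by
  rw [massContinuation_iff]
  constructor
  · exact fun h Nf hNf reg ε => h Nf hNf reg 0 ε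
  · intro h Nf hNf reg M ε
    have h' := h Nf hNf (upShift reg M) ε
    rw [at_upShift_iff, zero_add] at h'
    exact h'

/-- **Only small rates matter**: the instance at a rate `ε > 0` implies the instance at every `ε' ≥ ε`. [folklore] -/
theorem at_of_at_smaller {reg : QCDRegularisation Nf} {M ε ε' : ℝ} (hε : 0 < ε) (hle : ε ≤ ε')
    (h : At Nf reg M ε) : At Nf reg M ε' :=
  fun hMS _ hB hG => h hMS hε hB (fun m hm => hasLatticeMassGap_mono _ hle (hG m hm))

/-! ## §3 The uniform rate is load-bearing -/

/-- A per-tuple rate is already inside the body: hypothesis 2 with an `m`-dependent rate is free. [folklore] -/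
theorem gapAbove_pointwise_of_body {reg : QCDRegularisation Nf} {M : ℝ} (h : Body Nf reg M) :
    ∀ m : Fin Nf → ℝ, (∀ f, M < m f) → ∃ ε > 0, (reg.scheme m 0 0).HasLatticeMassGap ε := by
  intro m hm
  obtain ⟨z, shift, T, -, -, -, -, Δ, hΔ, -, hL⟩ := h m hm
  exact ⟨Δ, hΔ, hL⟩

/-- **The crux WITHOUT the uniform rate** ("the admissible thresholds form an open set"). Statement abbreviation. -/
def WithoutUniformGap : Prop :=
  ∀ Nf : ℕ, Nf = 2 ∨ Nf = 3 → ∀ (reg : QCDRegularisation Nf) (M : ℝ), reg.HasMassScaling →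
    Body Nf reg M → ∃ δ > 0, Body Nf reg (M - δ)

/-- **Least-admissible-threshold contradiction.**  For `N_f ≠ 0`: if some half-orthant is good, some tuple is gapless at
every positive rate, and goodness is open below EVERY admissible threshold, then `False` — the admissible thresholds
form a non-empty set bounded below (by the least component of the gapless tuple, since good tuples are gapped and
`HasLatticeMassGap` never reads `z, shift`), its infimum is admissible (strict orthants), and openness there contradicts
`csInf_le`. [folklore] -/
theorem false_of_openBelow [NeZero Nf] (reg : QCDRegularisation Nf)
    (hT : ∃ M₀ : ℝ, Body Nf reg M₀)
    (hG : ∃ m₀ : Fin Nf → ℝ, ∀ Δ, 0 < Δ → ¬ (reg.scheme m₀ 0 0).HasLatticeMassGap Δ)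
    (hO : ∀ M : ℝ, Body Nf reg M → ∃ δ > 0, Body Nf reg (M - δ)) : False := by
  classical
  set S : Set ℝ := {M | Body Nf reg M} with hS
  obtain ⟨M₀, hM₀⟩ := hT
  have hne : S.Nonempty := ⟨M₀, hM₀⟩
  obtain ⟨m₀, hm₀⟩ := hG
  have hbdd : BddBelow S := by
    refine ⟨Finset.univ.inf' Finset.univ_nonempty m₀, fun M hM => ?_⟩
    by_contra hlt
    push Not at hlt
    have hall : ∀ f, M < m₀ f := fun f =>
      lt_of_lt_of_le hlt (Finset.inf'_le _ (Finset.mem_univ f))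
    obtain ⟨z, shift, T, -, -, -, -, Δ, hΔ, -, hL⟩ := hM m₀ hall
    exact hm₀ Δ hΔ hL
  have hinf : Body Nf reg (sInf S) := by
    intro m hm
    have hlt : sInf S < Finset.univ.inf' Finset.univ_nonempty m :=
      (Finset.lt_inf'_iff _).2 fun f _ => hm f
    obtain ⟨M, hMS, hMt⟩ := exists_lt_of_csInf_lt hne hlt
    exact hMS m fun f => lt_of_lt_of_le hMt (Finset.inf'_le _ (Finset.mem_univ f))
  obtain ⟨δ, hδ, hP⟩ := hO (sInf S) hinf
  have hle : sInf S ≤ sInf S - δ := csInf_le hbdd hP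
  linarith

/-- **Hypothesis 2 is load-bearing** ("false without the uniform rate", modulo the two sibling pieces of the same
decomposition): threshold QCD and the gapless chiral tuple refute the gap-free variant. [folklore] -/
theorem not_withoutUniformGap_of (hT : QuarksAsStableAction.ThresholdQCD)
    (hG : QuarksAsStableAction.ChiralTupleGapless) : ¬ WithoutUniformGap := by
  intro hO
  obtain ⟨M₀, -, reg, hMS, hbody⟩ := hT 2 (Or.inl rfl)
  exact false_of_openBelow reg ⟨M₀, hbody⟩ (hG 2 (Or.inl rfl) reg M₀ hMS hbody)
    (fun M hM => hO 2 (Or.inl rfl) reg M hMS hM)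

/-! ## §4 The RP-wall obligation -/

/-- **The wall recedes**: any proof of the crux instance proves that the `m`-dependent physical-branch clause of
`IsQCDAlong` holds a little BELOW `M` as well. [folklore] -/
theorem branch_below_of_at {reg : QCDRegularisation Nf} {M ε : ℝ} (h : At Nf reg M ε)
    (hMS : reg.HasMassScaling) (hε : 0 < ε) (hB : Body Nf reg M) (hG : GapAbove reg M ε) :
    ∃ δ > 0, ∀ m : Fin Nf → ℝ, (∀ f, M - δ < m f) →
      ∀ fl : Fin Nf, ∀ᶠ k in atTop, -1 < reg.mcrit k + reg.a k * m fl / reg.Zm k := by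
  obtain ⟨δ, hδ, hB'⟩ := h hMS hε hB hG
  exact ⟨δ, hδ, fun m hm fl => body_branch_sliver hB' m hm fl⟩

variable (Nf) in
/-- **The wall regularisation**: `canonicalAF` (`a_k = 1/(k+1)`, `Z_m(k) = (log a_k⁻²)^{γ₀/(2β₀)}`) with the critical
mass parked at the reflection-positivity wall, `m_crit(k) = −1 − a_k (M − 1/(k+1)) / Z_m(k)`. [folklore] -/
def wallReg (M : ℝ) : QCDRegularisation Nf :=
  { QCDRegularisation.canonicalAF Nf with
    mcrit := fun k => -1 - (QCDRegularisation.canonicalAF Nf).a k * (M - ((k : ℝ) + 1)⁻¹) /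
      (QCDRegularisation.canonicalAF Nf).Zm k }

/-- The wall regularisation has leading-log mass scaling (it shares `a`, `Z_m` with `canonicalAF`). [folklore] -/
theorem wallReg_hasMassScaling (M : ℝ) : (wallReg Nf M).HasMassScaling :=
  QCDRegularisation.canonicalAF_hasMassScaling

/-- Its bare trajectories: `m_f(k) = −1 + (a_k / Z_m(k)) (m_f − M + 1/(k+1))`. [folklore] -/
theorem wallReg_mq (M : ℝ) (m : Fin Nf → ℝ) (z shift : QCDField Nf → ℕ → ℝ) (f : Fin Nf) (k : ℕ) :
    ((wallReg Nf M).scheme m z shift).mq f k =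
      -1 + (wallReg Nf M).a k / (wallReg Nf M).Zm k * (m f - M + ((k : ℝ) + 1)⁻¹) := by
  simp only [QCDRegularisation.scheme_mq, wallReg]
  ring

/-- At step `k` the trajectory of `m` is on the physical branch iff `m_f > M − 1/(k+1)`. [folklore] -/
theorem wallReg_branch_iff (M : ℝ) (m : Fin Nf → ℝ) (f : Fin Nf) (k : ℕ) :
    -1 < ((wallReg Nf M).scheme m 0 0).mq f k ↔ 0 < m f - M + ((k : ℝ) + 1)⁻¹ := by
  rw [wallReg_mq, lt_add_iff_pos_right]
  exact mul_pos_iff_of_pos_left (div_pos ((wallReg Nf M).a_pos k) ((wallReg Nf M).Zm_pos k))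

/-- **The wall sits AT the threshold**: the trajectory of `m` is eventually on the physical branch iff `M ≤ m_f`.
[folklore] -/
theorem wallReg_eventually_branch_iff (M : ℝ) (m : Fin Nf → ℝ) (f : Fin Nf) :
    (∀ᶠ k in atTop, -1 < ((wallReg Nf M).scheme m 0 0).mq f k) ↔ M ≤ m f := by
  simp only [wallReg_branch_iff]
  constructor
  · intro h
    by_contra hlt
    push Not at hlt
    have hθ : Tendsto (fun k : ℕ => ((k : ℝ) + 1)⁻¹) atTop (𝓝 0) :=
      tendsto_inv_atTop_zero.comp (tendsto_natCast_atTop_atTop.atTop_add tendsto_const_nhds)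
    have hev : ∀ᶠ k : ℕ in atTop, ((k : ℝ) + 1)⁻¹ < M - m f :=
      hθ.eventually (eventually_lt_nhds (by linarith))
    obtain ⟨k, hk₁, hk₂⟩ := (h.and hev).exists
    linarith
  · intro hle
    exact Eventually.of_forall fun k => by
      have hk : 0 < ((k : ℝ) + 1)⁻¹ := by positivity
      linarith

/-- **Below the wall the body fails for the formal reason alone** (no physics): a tuple with a component `< M` is not
eventually on the physical branch, so no OS data are `IsQCDAlong` its scheme. [folklore] -/
theorem not_bodyAt_wallReg {M : ℝ} {m : Fin Nf → ℝ} {f : Fin Nf} (hm : m f < M) :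
    ¬ BodyAt (wallReg Nf M) m := by
  rintro ⟨z, shift, T, hQ, -⟩
  have h' : ∀ᶠ k in atTop, -1 < ((wallReg Nf M).scheme m 0 0).mq f k := hQ.2.1 f
  exact absurd ((wallReg_eventually_branch_iff M m f).1 h') (not_le.2 hm)

/-- No half-orthant strictly below `M` is good for the wall regularisation (`N_f ≠ 0`). [folklore] -/
theorem not_body_wallReg [NeZero Nf] {M M' : ℝ} (hM : M' < M) : ¬ Body Nf (wallReg Nf M) M' :=
  fun h => not_bodyAt_wallReg (M := M) (m := fun _ => (M' + M) / 2) (f := 0) (by linarith)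
    (h _ fun _ => by linarith)

/-- **The crux instance at the wall is a NO-GO**: it says that `wallReg` does not carry body + uniform rate above `M`.
[folklore] -/
theorem wall_noGo_of_at [NeZero Nf] {M ε : ℝ} (hε : 0 < ε) (h : At Nf (wallReg Nf M) M ε) :
    ¬ (Body Nf (wallReg Nf M) M ∧ GapAbove (wallReg Nf M) M ε) := by
  rintro ⟨hB, hG⟩
  obtain ⟨δ, hδ, hB'⟩ := h (wallReg_hasMassScaling M) hε hB hG
  exact not_body_wallReg (by linarith) hB'

/-- **Hidden obligation of the crux**: for `N_f ∈ {2,3}` and every threshold `M` and rate `ε > 0`, `MassContinuation`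
proves that the wall regularisation does NOT carry the `QCDOf` body with one uniform lattice rate above `M` — a
decoupling / no-go theorem for Wilson quarks at `κ → 1/6⁻` along a two-loop asymptotically scaling sequence. [folklore] -/
theorem wall_noGo_of_massContinuation (h : QuarksAsStableAction.MassContinuation) (hNf : Nf = 2 ∨ Nf = 3)
    (M ε : ℝ) (hε : 0 < ε) :
    ¬ (Body Nf (wallReg Nf M) M ∧ GapAbove (wallReg Nf M) M ε) := by
  haveI : NeZero Nf := ⟨by rintro rfl; simp at hNf⟩
  exact wall_noGo_of_at hε (massContinuation_iff.1 h Nf hNf (wallReg Nf M) M ε)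

end Summit.QuantumFields.QCD.Theorems.MassContinuation.Negative

end
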